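import Summits.QuantumFields.YangMills.Theorems.ColdStartUniversalityLatticeLangevinTwoTimeLaw
import Summits.QuantumFields.YangMills.Theorems.ColdStartUniversalityLatticeLangevinTimeDecorrelation
import Summits.QuantumFields.YangMills.Theorems.ColdStartUniversalityLatticeLangevinWilsonReversibleMeasurable
import HarnessLib

/-!
# Route `ColdStartUniversality` (fixed-cut-off SZZ dynamics): ★★★ THE TWO-TIME LAW FORGETS THE START IN TOTAL VARIATION —
# `|E[H(U_s, U_(s+t))] − ∫∫ H(y,z) κ_t(y,dz) μ_(β')(dy)| ≤ C·e^(−cs)` for EVERY bounded measurable `H` of the pair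

Helper file (seat `ym-line-csu-p1`, g33; `--supports stmt-QuantumFields-24809`).  File 53 controls PRODUCT observables `F(U_s)G(U_(s+t))`; here the
joint law itself: by file 45 the law of `(U_s, U_(s+t))` is `κ_s(x,·) ⊗ₘ κ_t` EXACTLY (`map_pair_eq_compProd`, `integral_pair_eq_integral_integral_transition`),
and the every-start Harris bound (`abs_transition_sub_wilson_le_exp`) applied to the bounded measurable function `y ↦ ∫ H(y,z) κ_t(y,dz)` gives, for
EVERY strong solution of the SU(2) SZZ dynamics from a deterministic start on ANY space, every realising family `κ`, all `s, t` and every bounded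
measurable `H : X × X → ℝ` with `|H| ≤ 1`:
* ★★★ `abs_integral_pair_sub_stationary_le_exp` — `|E[H(U_s, U_(s+t))] − ∫ (∫ H(y,z) κ_t(y,dz)) dμ_(β')(y)| ≤ C·e^(−cs)`: the two-time law at waiting
  time `s` is `Ce^(−cs)`-close IN TOTAL VARIATION (dual form over all `|H| ≤ 1`) to the stationary two-time law `μ_(β') ⊗ₘ κ_t`;
* ★ `integral_wilson_transition_pair_eq` — the stationary two-time law is shift-invariant: `∫ κ_u(y ↦ ∫H(y,·)dκ_t(y)) dμ_(β') = ∫∫ H dκ_t dμ_(β')`.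
Constants `C, c > 0` depend on `L, β'` (Harris at fixed cut-off; every coupling).  THEOREMS ONLY, no definition, no sorry; [folklore].  HONEST FRAMING:
fixed cut-off; `UniformColdStartMixing` (24809) is NOT restated; no crux, rung or summit statement is proved; the Yang–Mills mass gap is NOT proved.
-/

set_option autoImplicit false

noncomputable section

namespace Summit.QuantumFields.YangMills.Theorems.ColdStartUniversality

open MeasureTheory ProbabilityTheory Filter Topology
open scoped NNReal ENNReal BigOperators
open Literature Literature.Probability.Process Literature.MathematicalPhysics.QuantumFieldTheory
open Literature.MathematicalPhysics.QuantumLattice (fundamentalRep fundamentalLatticeRep continuous_fundamentalRep)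

variable {L : ℕ} [NeZero L]

/-- ★★★ **The two-time law converges to the stationary two-time law in total variation.**  There are `C, c > 0` (depending on `L, β'`) such that
for every realising kernel family `κ`, EVERY strong solution `U` from a deterministic start on ANY space, all `s, t` and every bounded measurable
`H` on pairs of configurations with `|H| ≤ 1`: `|E[H(U_s, U_(s+t))] − ∫ (∫ H(y,z) κ_t(y,dz)) dμ_(β')(y)| ≤ C·e^(−cs)`. [folklore] -/
theorem abs_integral_pair_sub_stationary_le_exp (L : ℕ) [NeZero L] (β' : ℝ) :
    ∃ C c : ℝ, 0 < C ∧ 0 < c ∧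
      ∀ (κ : ℝ≥0 → Kernel (GaugeConfig 3 L (Matrix.specialUnitaryGroup (Fin 2) ℂ))
          (GaugeConfig 3 L (Matrix.specialUnitaryGroup (Fin 2) ℂ))) [∀ t, IsMarkovKernel (κ t)],
        (∀ (t : ℝ≥0) (x : GaugeConfig 3 L (Matrix.specialUnitaryGroup (Fin 2) ℂ))
          (Ω : Type) [MeasurableSpace Ω] (P : Measure Ω) [IsProbabilityMeasure P]
          (W : ℝ≥0 → Ω → (Edge 3 L × NoiseIdx 2 → ℝ)) (hW : IsFlatBrownian W P)
          (U : ℝ≥0 → Ω → GaugeConfig 3 L (Matrix.specialUnitaryGroup (Fin 2) ℂ)),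
          (∀ ω, U 0 ω = x) →
          (latticeLangevinDynamics (fundamentalLatticeRep 2) β').IsSolution (fundamentalRep (Fin 2))
            hW.natFiltration P W U →
          κ t x = P.map (U t)) →
        ∀ (x : GaugeConfig 3 L (Matrix.specialUnitaryGroup (Fin 2) ℂ))
          (Ω : Type) [MeasurableSpace Ω] (P : Measure Ω) [IsProbabilityMeasure P]
          (W : ℝ≥0 → Ω → (Edge 3 L × NoiseIdx 2 → ℝ)) (hW : IsFlatBrownian W P)
          (U : ℝ≥0 → Ω → GaugeConfig 3 L (Matrix.specialUnitaryGroup (Fin 2) ℂ)),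
          (∀ ω, U 0 ω = x) →
          (latticeLangevinDynamics (fundamentalLatticeRep 2) β').IsSolution (fundamentalRep (Fin 2)) hW.natFiltration P W U →
          ∀ (s t : ℝ≥0) (H : GaugeConfig 3 L (Matrix.specialUnitaryGroup (Fin 2) ℂ) × GaugeConfig 3 L (Matrix.specialUnitaryGroup (Fin 2) ℂ) → ℝ),
            Measurable H → (∀ q, |H q| ≤ 1) →
            |(∫ ω, H (U s ω, U (s + t) ω) ∂P) -
                ∫ y, (∫ z, H (y, z) ∂(κ t y)) ∂(wilsonMeasure (d := 3) (L := L) (fundamentalRep (Fin 2)) β')| ≤ C * Real.exp (-c * s) := by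
  classical
  obtain ⟨C, c, hC, hc, h⟩ := abs_transition_sub_wilson_le_exp L β'
  refine ⟨C, c, hC, hc, fun κ _ hreal x Ω _ P _ W hW U hU0 hU s t H hH hH1 => ?_⟩
  -- the inner function `y ↦ ∫ H(y,z) κ_t(y,dz)`, bounded by `1`
  have hIm : Measurable fun y => ∫ z, H (y, z) ∂(κ t y) := (hH.stronglyMeasurable.integral_kernel_prod_right' (κ := κ t)).measurable
  have hIb : ∀ y, |∫ z, H (y, z) ∂(κ t y)| ≤ 1 := fun y => by
    have hh := norm_integral_le_of_norm_le_const (μ := κ t y) (f := fun z => H (y, z)) (C := 1)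
      (Eventually.of_forall fun z => by simpa [Real.norm_eq_abs] using hH1 (y, z))
    simpa [Real.norm_eq_abs] using hh
  rw [integral_pair_eq_integral_integral_transition β' κ hreal x hW hU0 hU s t hH hH1]
  exact h κ hreal _ hIm hIb s x

/-- ★ **Shift-invariance of the stationary two-time law**: `∫ (∫ (∫ H(z,w) κ_t(z,dw)) κ_u(y,dz)) dμ_(β')(y) = ∫ (∫ H(y,w) κ_t(y,dw)) dμ_(β')(y)` for every
waiting time `u` (invariance of the Wilson–Gibbs measure under THE kernels). [cite: ShenZhuZhu2022, §3 Lemma 3.3 (p. 13)] -/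
theorem integral_wilson_transition_pair_eq (β' : ℝ)
    (κ : ℝ≥0 → Kernel (GaugeConfig 3 L (Matrix.specialUnitaryGroup (Fin 2) ℂ))
      (GaugeConfig 3 L (Matrix.specialUnitaryGroup (Fin 2) ℂ))) [∀ t, IsMarkovKernel (κ t)]
    (hreal : ∀ (t : ℝ≥0) (x : GaugeConfig 3 L (Matrix.specialUnitaryGroup (Fin 2) ℂ))
        (Ω : Type) [MeasurableSpace Ω] (P : Measure Ω) [IsProbabilityMeasure P]
        (W : ℝ≥0 → Ω → (Edge 3 L × NoiseIdx 2 → ℝ)) (hW : IsFlatBrownian W P)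
        (U : ℝ≥0 → Ω → GaugeConfig 3 L (Matrix.specialUnitaryGroup (Fin 2) ℂ)),
        (∀ ω, U 0 ω = x) →
        (latticeLangevinDynamics (fundamentalLatticeRep 2) β').IsSolution (fundamentalRep (Fin 2))
          hW.natFiltration P W U →
        κ t x = P.map (U t))
    (u t : ℝ≥0) {H : GaugeConfig 3 L (Matrix.specialUnitaryGroup (Fin 2) ℂ) × GaugeConfig 3 L (Matrix.specialUnitaryGroup (Fin 2) ℂ) → ℝ}
    (hH : Measurable H) {CH : ℝ} (hHb : ∀ q, |H q| ≤ CH) :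
    ∫ y, (∫ z, (∫ w, H (z, w) ∂(κ t z)) ∂(κ u y)) ∂(wilsonMeasure (d := 3) (L := L) (fundamentalRep (Fin 2)) β') =
      ∫ y, (∫ w, H (y, w) ∂(κ t y)) ∂(wilsonMeasure (d := 3) (L := L) (fundamentalRep (Fin 2)) β') := by
  have hIm : Measurable fun y => ∫ w, H (y, w) ∂(κ t y) := (hH.stronglyMeasurable.integral_kernel_prod_right' (κ := κ t)).measurable
  have hIb : ∀ y, |∫ w, H (y, w) ∂(κ t y)| ≤ CH := fun y => by
    have hh := norm_integral_le_of_norm_le_const (μ := κ t y) (f := fun w => H (y, w)) (C := CH)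
      (Eventually.of_forall fun w => by simpa [Real.norm_eq_abs] using hHb (y, w))
    simpa [Real.norm_eq_abs] using hh
  exact integral_transitionKernel_integral_eq_wilson (L := L) β' κ hreal u hIm ⟨CH, hIb⟩

/-- ★★ **Solution form of the stationary two-time law as a limit**: for every strong solution `U` from a deterministic start, all `s, t` and every
bounded measurable `H` with `|H| ≤ 1`, the two-time expectation at waiting time `s + u` and at waiting time `s` differ by at most `2C·e^(−cs)` —
`E[H(U_(s+u), U_(s+u+t))]` is Cauchy in the waiting time, exponentially fast. [folklore] -/
theorem abs_integral_pair_shift_sub_le_exp (L : ℕ) [NeZero L] (β' : ℝ) :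
    ∃ C c : ℝ, 0 < C ∧ 0 < c ∧
      ∀ (x : GaugeConfig 3 L (Matrix.specialUnitaryGroup (Fin 2) ℂ))
        (Ω : Type) [MeasurableSpace Ω] (P : Measure Ω) [IsProbabilityMeasure P]
        (W : ℝ≥0 → Ω → (Edge 3 L × NoiseIdx 2 → ℝ)) (hW : IsFlatBrownian W P)
        (U : ℝ≥0 → Ω → GaugeConfig 3 L (Matrix.specialUnitaryGroup (Fin 2) ℂ)),
        (∀ ω, U 0 ω = x) →
        (latticeLangevinDynamics (fundamentalLatticeRep 2) β').IsSolution (fundamentalRep (Fin 2)) hW.natFiltration P W U →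
        ∀ (s u t : ℝ≥0) (H : GaugeConfig 3 L (Matrix.specialUnitaryGroup (Fin 2) ℂ) × GaugeConfig 3 L (Matrix.specialUnitaryGroup (Fin 2) ℂ) → ℝ),
          Measurable H → (∀ q, |H q| ≤ 1) →
          |(∫ ω, H (U (s + u) ω, U (s + u + t) ω) ∂P) - ∫ ω, H (U s ω, U (s + t) ω) ∂P| ≤ 2 * C * Real.exp (-c * s) := by
  classical
  obtain ⟨C, c, hC, hc, h⟩ := abs_integral_pair_sub_stationary_le_exp L β'
  refine ⟨C, c, hC, hc, fun x Ω _ P _ W hW U hU0 hU s u t H hH hH1 => ?_⟩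
  obtain ⟨κ, hκM, -, hreal⟩ := exists_transitionKernel L β'
  haveI := hκM
  have h1 := h κ hreal x Ω P W hW U hU0 hU (s + u) t H hH hH1
  have h2 := h κ hreal x Ω P W hW U hU0 hU s t H hH hH1
  have hexp : Real.exp (-c * ((s + u : ℝ≥0) : ℝ)) ≤ Real.exp (-c * (s : ℝ)) :=
    Real.exp_le_exp.2 (by push_cast; nlinarith [NNReal.coe_nonneg u])
  rw [abs_sub_le_iff] at h1 h2
  rw [abs_le]
  constructor <;> nlinarith [h1.1, h1.2, h2.1, h2.2, hexp, hC.le]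

end Summit.QuantumFields.YangMills.Theorems.ColdStartUniversality

end
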